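import Summits.RiemannHypothesis.RiemannHypothesis.Theorems.SoloInformedCombPocket
import HarnessLib

/-!
# T71a — comb packets: window tests concentrated at one height and blind on a comb

The test vector of T70 (`SoloInformedCombPocket`) is isolated here as an object with three
properties, so that BOTH sides of the explicit formula can be evaluated on it:

* (`exists_comb_packet`, RH-free) for every spacing parameter `τ ≥ 1`, height `h` and radius
  `R ≥ C` there is a test `g` with `supp g ⊆ [-(1+τ), 1+τ]`, `‖g‖₂ > 0`, whose transform on the
  critical line VANISHES on the comb `h + (π/τ)ℤ` and is CONCENTRATED at height `h`:
  `(1 + (t-h)²) |ĝ(1/2+it)|² ≤ C (1+R²) e^{-R/C} ‖g‖₂²` for `|t - h| ≥ R`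
  (`g(x) = e^{-ihx}(Φ(x+τ) - Φ(x-τ))` with `Φ` the scale-adapted test of T70a);
* (`re_weilQuadratic_le_of_combPocket`, RH) the ZERO SIDE of such a packet in a comb pocket —
  every ordinate `γ` with `|γ - h| ≤ R` within `u` of the comb — is small:
  `Re Q(g) ≤ 2A₁ log(|h|+2) ((1+R²) 2a³u² + D) ‖g‖₂²`, where `D` is the concentration constant
  and `supp g ⊆ [-a, a]` (pocket zeros by the Lipschitz bound of T63, far zeros by the
  concentration, summed by the Cauchy-majorant zero side T9a).

T70 is the special case `D = C(1+R²)e^{-R/C}` read through `ε(a) ≤ Re Q(g)/‖g‖₂²`; the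
geometric side of the same packet is evaluated in `SoloInformedPocketExclusion` (T71).
-/

open Complex Set Filter MeasureTheory Literature.NumberTheory.LFunctions
open scoped Real Topology

namespace Summit.RiemannHypothesis.RiemannHypothesis.Theorems

/-- **Comb packets exist (no hypothesis).** There is `C > 0` such that for all `τ ≥ 1`, `h` and
`R ≥ C` some Weil test `g` with `tsupport g ⊆ [-(1+τ), 1+τ]` and `‖g‖₂ > 0` has
`ĝ(1/2 + i(h + kπ/τ)) = 0` for every `k : ℤ` and
`(1 + (t-h)²) ‖ĝ(1/2+it)‖² ≤ C (1+R²) e^{-R/C} ‖g‖₂²` whenever `|t - h| ≥ R`. -/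
theorem exists_comb_packet :
    ∃ C : ℝ, 0 < C ∧ ∀ τ h R : ℝ, 1 ≤ τ → C ≤ R → ∃ g : ℝ → ℂ, IsWeilTest g ∧
      tsupport g ⊆ Icc (-(1 + τ)) (1 + τ) ∧ 0 < ∫ x, ‖g x‖ ^ 2 ∧
      (∀ k : ℤ, weilMellin g (1 / 2 + ((h + k * π / τ : ℝ) : ℂ) * I) = 0) ∧
      ∀ t : ℝ, R ≤ |t - h| →
        (1 + (t - h) ^ 2) * ‖weilMellin g (1 / 2 + t * I)‖ ^ 2 ≤
          C * (1 + R ^ 2) * Real.exp (-(R / C)) * ∫ x, ‖g x‖ ^ 2 := by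
  obtain ⟨C, hC, hdecay⟩ := exists_test_exp_decay
  refine ⟨2 * C, by positivity, fun τ h R hτ hR ↦ ?_⟩
  have hRC : C ≤ R := by linarith
  have hτ0 : 0 < τ := by linarith
  obtain ⟨Φ, hΦ, hΦs, hEΦ, hfar⟩ := hdecay R hRC
  obtain ⟨G, hG⟩ : ∃ G : ℝ → ℂ, G = fun x ↦ Φ (x + τ) - Φ (x - τ) := ⟨_, rfl⟩
  have hGt : IsWeilTest G := hG ▸ isWeilTest_comb hΦ τ
  have hGs : tsupport G ⊆ Icc (-(1 + τ)) (1 + τ) := hG ▸ tsupport_comb_subset hΦs hτ0.le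
  obtain ⟨g, hg⟩ : ∃ g : ℝ → ℂ, g = fun x ↦ G x * cexp (((-h) * x : ℝ) * I) := ⟨_, rfl⟩
  have hgt : IsWeilTest g := hg ▸ isWeilTest_mul_cexp_ofReal_mul_I hGt (-h)
  have hgs : tsupport g ⊆ Icc (-(1 + τ)) (1 + τ) := by
    rw [hg]
    exact (tsupport_mul_cexp_subset G (-h)).trans hGs
  have hgm : ∀ y : ℝ, weilMellin g (1 / 2 + y * I) =
      weilMellin G (1 / 2 + ((y - h : ℝ) : ℂ) * I) := by
    intro y
    rw [hg, weilMellin_mul_cexp_ofReal_mul_I_half, ← sub_eq_add_neg]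
  have hGm : ∀ s : ℝ, weilMellin G (1 / 2 + s * I) =
      -(2 * I * (Real.sin (s * τ) : ℂ)) * weilMellin Φ (1 / 2 + s * I) := by
    intro s
    rw [hG]
    exact weilMellin_comb hΦ τ s
  have hgnorm : ∀ y : ℝ, ‖weilMellin g (1 / 2 + y * I)‖ ^ 2 ≤
      4 * ‖weilMellin Φ (1 / 2 + ((y - h : ℝ) : ℂ) * I)‖ ^ 2 := by
    intro y
    rw [hgm, hGm]
    exact norm_sq_sin_factor_le _ _
  -- norms: `‖g‖₂² = ‖G‖₂² = 2 ‖Φ‖₂²`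
  obtain ⟨E, hE⟩ : ∃ E : ℝ, E = ∫ x, ‖g x‖ ^ 2 := ⟨_, rfl⟩
  have hEeq : E = 2 * ∫ x, ‖Φ x‖ ^ 2 := by
    rw [hE, ← integral_norm_sq_comb_eq hΦ hΦs hτ, hG] at *
    rw [hg]
    congr 1 with x
    rw [norm_mul, Complex.norm_exp_ofReal_mul_I, mul_one]
  have hEpos : 0 < E := by rw [hEeq]; positivity
  have hexp : Real.exp (-(R / C)) ≤ Real.exp (-(R / (2 * C))) := by
    rw [Real.exp_le_exp, neg_le_neg_iff]
    exact div_le_div_of_nonneg_left (hC.le.trans hRC) hC (by linarith)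
  refine ⟨g, hgt, hgs, hE ▸ hEpos, fun k ↦ ?_, fun t ht ↦ ?_⟩
  · rw [hgm, add_sub_cancel_left, hG]
    exact weilMellin_comb_lattice_eq_zero hΦ hτ0.ne' k
  · rw [← hE, hEeq]
    calc (1 + (t - h) ^ 2) * ‖weilMellin g (1 / 2 + t * I)‖ ^ 2
        ≤ (1 + (t - h) ^ 2) * (4 * ‖weilMellin Φ (1 / 2 + ((t - h : ℝ) : ℂ) * I)‖ ^ 2) :=
          mul_le_mul_of_nonneg_left (hgnorm t) (by positivity)
      _ = 4 * ((1 + (t - h) ^ 2) * ‖weilMellin Φ (1 / 2 + ((t - h : ℝ) : ℂ) * I)‖ ^ 2) := by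
          ring
      _ ≤ 4 * (C * (1 + R ^ 2) * Real.exp (-(R / C)) * ∫ x, ‖Φ x‖ ^ 2) :=
          mul_le_mul_of_nonneg_left (hfar (t - h) ht) (by norm_num)
      _ ≤ 4 * (C * (1 + R ^ 2) * Real.exp (-(R / (2 * C))) * ∫ x, ‖Φ x‖ ^ 2) := by
          gcongr
      _ = 2 * C * (1 + R ^ 2) * Real.exp (-(R / (2 * C))) * (2 * ∫ x, ‖Φ x‖ ^ 2) := by
          ring

/-- **The zero side of a comb packet in a comb pocket (RH).** There is `A₁ > 0` such that for
every Weil test `g` with `tsupport g ⊆ [-a, a]` (`a ≥ 0`) whose transform vanishes on the comb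
`h + (π/τ)ℤ` and satisfies `(1 + (t-h)²) ‖ĝ(1/2+it)‖² ≤ D ‖g‖₂²` for `|t - h| ≥ R` (`D ≥ 0`):
if every ordinate `γ` of a zero `ζ(1/2+iγ) = 0` with `|γ - h| ≤ R` lies within `u ≥ 0` of the
comb, then `Re Q(g) ≤ 2A₁ log(|h|+2) ((1+R²) 2a³u² + D) ‖g‖₂²`. Pocket zeros: the Lipschitz
bound `norm_weilMellin_line_sub_le` from the nearest comb node; far zeros: the concentration;
all zeros are these under RH, summed by `exists_finsum_weilZeroIndex_le_of_kernel_bound`. -/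
theorem re_weilQuadratic_le_of_combPocket (hRH : RiemannHypothesis) :
    ∃ A₁ : ℝ, 0 < A₁ ∧ ∀ (g : ℝ → ℂ) (a τ h R u D : ℝ), IsWeilTest g →
      tsupport g ⊆ Icc (-a) a → 0 ≤ a → 0 ≤ u → 0 ≤ D →
      (∀ k : ℤ, weilMellin g (1 / 2 + ((h + k * π / τ : ℝ) : ℂ) * I) = 0) →
      (∀ t : ℝ, R ≤ |t - h| →
        (1 + (t - h) ^ 2) * ‖weilMellin g (1 / 2 + t * I)‖ ^ 2 ≤ D * ∫ x, ‖g x‖ ^ 2) →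
      (∀ γ : ℝ, riemannZeta (1 / 2 + γ * I) = 0 → |γ - h| ≤ R →
        ∃ k : ℤ, |γ - h - k * π / τ| ≤ u) →
      (weilQuadratic g).re ≤
        2 * A₁ * Real.log (|h| + 2) * ((1 + R ^ 2) * (2 * a ^ 3 * u ^ 2) + D) *
          ∫ x, ‖g x‖ ^ 2 := by
  classical
  obtain ⟨A₁, hA₁, hK⟩ := exists_finsum_weilZeroIndex_le_of_kernel_bound
  refine ⟨A₁, hA₁, fun g a τ h R u D hgt hgs ha0 hu hD hlat hfar hpocket ↦ ?_⟩
  obtain ⟨E, hE⟩ : ∃ E : ℝ, E = ∫ x, ‖g x‖ ^ 2 := ⟨_, rfl⟩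
  rw [← hE] at hfar ⊢
  have hE0 : 0 ≤ E := by rw [hE]; exact integral_nonneg fun x ↦ by positivity
  -- pocket zeros: Lipschitz from the nearest comb node
  have hnear : ∀ γ : ℝ, (∃ k : ℤ, |γ - h - k * π / τ| ≤ u) →
      ‖weilMellin g (1 / 2 + γ * I)‖ ^ 2 ≤ 2 * a ^ 3 * u ^ 2 * E := by
    rintro γ ⟨k, hk⟩
    have hL := norm_weilMellin_line_sub_le hgt hgs ha0 γ (h + k * π / τ)
    rw [hlat k, sub_zero, ← hE, show γ - (h + k * π / τ) = γ - h - k * π / τ by ring] at hL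
    have hK0 : 0 ≤ a * (Real.sqrt (2 * a) * Real.sqrt E) := by positivity
    have h1 : ‖weilMellin g (1 / 2 + γ * I)‖ ≤ a * (Real.sqrt (2 * a) * Real.sqrt E) * u :=
      hL.trans (mul_le_mul_of_nonneg_left hk hK0)
    have h2 := pow_le_pow_left₀ (norm_nonneg _) h1 2
    have h3 : (a * (Real.sqrt (2 * a) * Real.sqrt E) * u) ^ 2 = 2 * a ^ 3 * u ^ 2 * E := by
      rw [mul_pow, mul_pow, mul_pow, Real.sq_sqrt (by positivity), Real.sq_sqrt hE0]
      ring
    rw [h3] at h2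
    exact h2
  -- far zeros: the concentration
  have hfar' : ∀ γ : ℝ, R ≤ |γ - h| →
      ‖weilMellin g (1 / 2 + γ * I)‖ ^ 2 ≤ D * E / (1 + (γ - h) ^ 2) := by
    intro γ hγ
    rw [le_div_iff₀ (by positivity)]
    linarith [hfar γ hγ]
  -- the Cauchy majorant on the closed strip, under RH
  obtain ⟨M, hM⟩ : ∃ M : ℝ, M = ((1 + R ^ 2) * (2 * a ^ 3 * u ^ 2) + D) * E := ⟨_, rfl⟩
  have hM0 : 0 ≤ M := by rw [hM]; positivity
  obtain ⟨F, hF⟩ : ∃ F : ℂ → ℝ,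
      F = fun ρ ↦ if riemannZeta ρ = 0 ∧ ρ.im ≠ 0 then ‖weilMellin g ρ‖ ^ 2 else 0 :=
    ⟨_, rfl⟩
  have hmaj : ∀ ρ : ℂ, 0 ≤ ρ.re → ρ.re ≤ 1 → F ρ ≤ M / (1 + (ρ.im - h) ^ 2) := by
    intro ρ h0 h1
    rw [hF]
    dsimp only
    split_ifs with hz
    · obtain ⟨hζ, him⟩ := hz
      have hre : ρ.re = 1 / 2 := by
        refine hRH ρ hζ ?_ ?_
        · rintro ⟨n, hn⟩
          have : ρ.im = 0 := by rw [hn]; simp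
          exact him this
        · rintro rfl
          simp at him
      have hρ : (1 / 2 : ℂ) + ((ρ.im : ℝ) : ℂ) * I = ρ := by
        apply Complex.ext <;> simp [hre]
      have hζ' : riemannZeta (1 / 2 + (ρ.im : ℝ) * I) = 0 := by rw [hρ]; exact hζ
      rcases le_or_gt |ρ.im - h| R with hle | hlt
      · -- pocket zero
        have hb := hnear ρ.im (hpocket ρ.im hζ' hle)
        rw [hρ] at hb
        rw [le_div_iff₀ (by positivity), hM]
        have hsq : (ρ.im - h) ^ 2 ≤ R ^ 2 := by
          have := abs_le.1 hle
          nlinarith [this.1, this.2]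
        have hDE : 0 ≤ D * E := by positivity
        calc ‖weilMellin g ρ‖ ^ 2 * (1 + (ρ.im - h) ^ 2)
            ≤ 2 * a ^ 3 * u ^ 2 * E * (1 + R ^ 2) :=
              mul_le_mul hb (by linarith) (by positivity) (by positivity)
          _ ≤ 2 * a ^ 3 * u ^ 2 * E * (1 + R ^ 2) + D * E := le_add_of_nonneg_right hDE
          _ = ((1 + R ^ 2) * (2 * a ^ 3 * u ^ 2) + D) * E := by ring
      · -- far zero
        have hb := hfar' ρ.im hlt.le
        rw [hρ] at hb
        refine hb.trans (div_le_div_of_nonneg_right ?_ (by positivity))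
        rw [hM]
        have hpos2 : 0 ≤ (1 + R ^ 2) * (2 * a ^ 3 * u ^ 2) * E := by positivity
        linarith
    · positivity
  -- zero sums and the explicit formula
  have hZ : ∀ T : ℝ, ∑ᶠ ρ ∈ weilZeroIndex T,
      (riemannZetaZeroOrder ρ : ℝ) * ‖weilMellin g ρ‖ ^ 2 ≤ 2 * A₁ * M * Real.log (|h| + 2) := by
    intro T
    have hcongr : ∑ᶠ ρ ∈ weilZeroIndex T, (riemannZetaZeroOrder ρ : ℝ) * ‖weilMellin g ρ‖ ^ 2 =
        ∑ᶠ ρ ∈ weilZeroIndex T, (riemannZetaZeroOrder ρ : ℝ) * F ρ := by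
      refine finsum_mem_congr rfl fun ρ hρ ↦ ?_
      rw [hF]
      dsimp only
      rw [if_pos ⟨hρ.1, hρ.2.2.2.1⟩]
    rw [hcongr]
    exact hK F M h hM0 hmaj T
  calc (weilQuadratic g).re ≤ 2 * A₁ * M * Real.log (|h| + 2) :=
      re_weilQuadratic_le_of_zeroSum_le hgt hZ
    _ = 2 * A₁ * Real.log (|h| + 2) * ((1 + R ^ 2) * (2 * a ^ 3 * u ^ 2) + D) * E := by
      rw [hM]; ring

end Summit.RiemannHypothesis.RiemannHypothesis.Theorems
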